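import Summits.QuantumFields.YangMills.Theorems.InfiniteVolumeTorusApproximation
import HarnessLib

/-!
# Infinite volume by compactness, STATE-LEVEL engine: the ceiling-free (A)↔(B) junction

Support file for `DyadicChessboard.DyadicCalibration` (stmt-QuantumFields-23371).  The landed per-order junctions
(`InfiniteVolume.PerOrder*.exists_torusSides_approximating`) choose, for given couplings `β_k`, odd-torus limit states
`μ_k` and a growth demand, torus sides `L_k` along which the spine's TORUS plane-string distributions are asymptotic to
the infinite-volume series of `μ_k` on every `⁰𝒮ₙ`; their `ε/3` density step needs an a-UNIFORM bound of the torus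
functionals, i.e. the collar ceilings ON THE ODD TORI.  The dyadic route has no odd-torus ceilings.  This file proves
the junction WITHOUT ANY CEILING: at a fixed level the torus functionals converge to the infinite-volume series in
OPERATOR norm with respect to `schwartzNorm (6n)` (Tannery with the test-function-free majorant
`2^{6n} ∏ₗ 2⁶(1 + a‖x_l‖)⁻⁶` of `norm_apply_le_schwartzNorm_mul_prod`, summable by `sum_prod_decay_le`), and the
diagonal selection `exists_growth_diagonal` is run on the defect majorants themselves — no dense family, no
equicontinuity.  Only boundedness of the plane fields and Schwartz decay are used.

WHAT IS PROVED ([folklore]; soft analysis): `summable_prod_decay`, `exists_defect_tendsto_zero` (operator-norm torus →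
infinite volume at fixed spacing), `exists_torusSides_approximating` (the junction for GIVEN states, for every Schwartz
test function).

HONEST FRAMING: nothing here is a statement about Bałaban's renormalisation group, reflection positivity, chessboard
estimates, a mass gap or Clay; no summit is proved (rung R2a plumbing).  Width seat ym-line-sfw-p2-w2 g23.

References: Glimm–Jaffe (1987) §6.1; Osterwalder–Schrader CMP 42 (1975) §2; Chatterjee arXiv:1803.01950 §2.
-/

set_option autoImplicit false

noncomputable section

open scoped BigOperators SchwartzMap
open MeasureTheory Filter Topology
open Literature.MathematicalPhysics.QuantumFieldTheory hiding ZdEdge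
open Literature.MathematicalPhysics.QuantumLattice
open Literature.MathematicalPhysics.AQFT
open Literature.Probability.LatticeModels (box Site)
open Summit.QuantumFields.YangMills.Cruxes.OSLegsFromFemtoAndGap.DlrCollarTransfer (plane exists_abs_plane_le)
open Summit.QuantumFields.YangMills.Theorems.OSLegsFromFemtoAndGap
  (torusMomentStr latticeDistStr latticeDistStr_apply abs_torusMomentStr_plane_le sum_prod_decay_le)

namespace Summit.QuantumFields.YangMills.Theorems.InfiniteVolume.PerOrderState

/-! ## §1 The test-function-free lattice majorant is summable -/

/-- For `0 < a ≤ 1` the majorant `x ↦ ∏ₗ 2⁶ (1 + a‖x_l‖)⁻⁶` is summable over `(ℤ⁴)ⁿ` (its box sums are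
`≤ (2⁶ a⁻⁴)ⁿ Zⁿ`, `Z = 81 Σ (m+1)⁻²`, by `sum_prod_decay_le`). [folklore] -/
theorem summable_prod_decay {a : ℝ} (ha : 0 < a) (ha1 : a ≤ 1) (n : ℕ) :
    Summable fun x : Fin n → Site 4 => ∏ i, ((2 : ℝ) ^ 6 * ((1 + a * ‖x i‖) ^ 6)⁻¹) := by
  classical
  have h4 : (a : ℝ) ^ 4 ≠ 0 := pow_ne_zero 4 ha.ne'
  have hfac : ∀ x : Fin n → Site 4, ∏ i, ((2 : ℝ) ^ 6 * ((1 + a * ‖x i‖) ^ 6)⁻¹) =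
      (2 ^ 6 * (a ^ 4)⁻¹) ^ n * ∏ i, (a ^ 4 * ((1 + a * ‖x i‖) ^ 6)⁻¹) := fun x => by
    have hi : ∀ i : Fin n, (2 : ℝ) ^ 6 * ((1 + a * ‖x i‖) ^ 6)⁻¹ =
        (2 ^ 6 * (a ^ 4)⁻¹) * (a ^ 4 * ((1 + a * ‖x i‖) ^ 6)⁻¹) := fun i => by
      rw [mul_assoc, ← mul_assoc ((a ^ 4)⁻¹), inv_mul_cancel₀ h4, one_mul]
    rw [Finset.prod_congr rfl fun i _ => hi i, Finset.prod_mul_distrib, Finset.prod_const, Finset.card_univ,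
      Fintype.card_fin]
  refine summable_of_sum_le (c := (2 ^ 6 * (a ^ 4)⁻¹) ^ n * (81 * ∑' m : ℕ, (((m : ℝ) + 1) ^ 2)⁻¹) ^ n)
    (fun x => by positivity) fun T => ?_
  obtain ⟨L, -, hTL⟩ := subset_piFinset_box T 0
  calc ∑ x ∈ T, ∏ i, ((2 : ℝ) ^ 6 * ((1 + a * ‖x i‖) ^ 6)⁻¹)
      ≤ ∑ x ∈ Fintype.piFinset (fun _ : Fin n => box 4 L), ∏ i, ((2 : ℝ) ^ 6 * ((1 + a * ‖x i‖) ^ 6)⁻¹) :=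
        Finset.sum_le_sum_of_subset_of_nonneg hTL fun x _ _ => by positivity
    _ = (2 ^ 6 * (a ^ 4)⁻¹) ^ n *
        ∑ x ∈ Fintype.piFinset (fun _ : Fin n => box 4 L), ∏ i, (a ^ 4 * ((1 + a * ‖x i‖) ^ 6)⁻¹) := by
        rw [Finset.mul_sum]; exact Finset.sum_congr rfl fun x _ => hfac x
    _ ≤ (2 ^ 6 * (a ^ 4)⁻¹) ^ n * (81 * ∑' m : ℕ, (((m : ℝ) + 1) ^ 2)⁻¹) ^ n :=
        mul_le_mul_of_nonneg_left (sum_prod_decay_le ha ha1 (le_refl 6) (box 4 L) n) (by positivity)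

/-! ## §2 Operator-norm convergence torus → infinite volume at fixed spacing -/

section Junction

variable {G : Type} [Group G] [TopologicalSpace G] [IsTopologicalGroup G] [CompactSpace G]
  [MeasurableSpace G] [BorelSpace G]

/-- **TORUS → INFINITE VOLUME AT FIXED SPACING, IN OPERATOR NORM.**  Along `IsInfiniteVolumeLimitAlong r.ρ β (2S·) μ`
with `S` strictly increasing and `0 < a ≤ 1`, for every string `q` there are defects `δ m → 0` with
`‖latticeDistStr r.ρ β (S m) a (planes q) (torus means) F − Σ'ₓ W_μ(q,x)·F(a·x)‖ ≤ δ m · schwartzNorm (6n) F` for EVERY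
Schwartz `F` and every `m` (the torus weights converge pointwise and are bounded by `(Cₚ+Cₚ)ⁿ`; the defect is
dominated by the test-function-free summable majorant of §1; Tannery).  No moment bound is used. [folklore] -/
theorem exists_defect_tendsto_zero (r : LatticeRep G) {β : ℝ} {S : ℕ → ℕ} (hS : StrictMono S)
    {μ : Measure (LGConfig 4 G)} (hlim : IsInfiniteVolumeLimitAlong (d := 4) r.ρ β (fun k => 2 * S k) μ)
    {a : ℝ} (ha : 0 < a) (ha1 : a ≤ 1) {n : ℕ} (q : Fin n → Fin 4 × Fin 4) :
    ∃ δ : ℕ → ℝ, Tendsto δ atTop (𝓝 0) ∧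
      ∀ (m : ℕ) (F : 𝓢((Fin n → EuclideanSpace ℝ (Fin 4)), ℂ)),
        ‖latticeDistStr r.ρ β (S m) a (fun i U => plaquetteObs r.ρ 0 (q i).1 (q i).2 U)
            (fun i => wilsonTorusMean r.ρ β (S m) (fun U => plaquetteObs r.ρ 0 (q i).1 (q i).2 U)) F -
          ∑' x : Fin n → Site 4,
            (((∫ U, ∏ i, (plane G r (q i) (x i) U - ∫ V, plane G r (q i) (x i) V ∂μ) ∂μ : ℝ) : ℂ)) *
              F (fun l => a • siteToE (x l))‖ ≤ δ m * schwartzNorm (6 * n) F := by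
  classical
  haveI : IsProbabilityMeasure μ := hlim.1
  obtain ⟨Cp, hCp⟩ := exists_abs_plane_le (G := G) r
  have hCp0 : 0 ≤ Cp := le_trans (abs_nonneg _) (hCp (0, 1) 0 (fun _ => 1))
  have hB : 0 ≤ (Cp + Cp) ^ n := by positivity
  have hsa : (0 : ℝ) * a ≤ 1 / 4 := by norm_num
  -- torus weights, limit weights, defect weights, majorant
  set tm : ℕ → (Fin n → Site 4) → ℝ := fun m x => torusMomentStr r.ρ β (S m)
    (fun i U => plaquetteObs r.ρ 0 (q i).1 (q i).2 U)
    (fun i => wilsonTorusMean r.ρ β (S m) (fun U => plaquetteObs r.ρ 0 (q i).1 (q i).2 U)) x with htm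
  set W : (Fin n → Site 4) → ℝ := fun x =>
    ∫ U, ∏ i, (plane G r (q i) (x i) U - ∫ V, plane G r (q i) (x i) V ∂μ) ∂μ with hW
  set w : ℕ → (Fin n → Site 4) → ℝ := fun m x =>
    (if x ∈ Fintype.piFinset (fun _ : Fin n => box 4 (S m)) then tm m x else 0) - W x with hw
  set g : (Fin n → Site 4) → ℝ := fun x => ∏ i, ((2 : ℝ) ^ 6 * ((1 + a * ‖x i‖) ^ 6)⁻¹) with hg
  have hg0 : ∀ x, 0 ≤ g x := fun x => by positivity
  have hgsum : Summable g := summable_prod_decay ha ha1 n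
  have hWle : ∀ x, |W x| ≤ (Cp + Cp) ^ n := fun x => abs_infVolWeight_le r hCp μ q x
  have htmle : ∀ m x, |tm m x| ≤ (Cp + Cp) ^ n := fun m x => abs_torusMomentStr_plane_le r hCp β (S m) q x
  have hcut : ∀ m x, |(if x ∈ Fintype.piFinset (fun _ : Fin n => box 4 (S m)) then tm m x else 0)| ≤
      (Cp + Cp) ^ n := fun m x => by
    split_ifs
    · exact htmle m x
    · rw [abs_zero]; exact hB
  have hwle : ∀ m x, |w m x| ≤ 2 * (Cp + Cp) ^ n := fun m x =>
    calc |w m x| ≤ |(if x ∈ Fintype.piFinset (fun _ : Fin n => box 4 (S m)) then tm m x else 0)| + |W x| :=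
          abs_sub _ _
      _ ≤ (Cp + Cp) ^ n + (Cp + Cp) ^ n := add_le_add (hcut m x) (hWle x)
      _ = 2 * (Cp + Cp) ^ n := by ring
  have hwg : ∀ m, Summable fun x => |w m x| * g x := fun m =>
    (hgsum.mul_left (2 * (Cp + Cp) ^ n)).of_nonneg_of_le (fun x => mul_nonneg (abs_nonneg _) (hg0 x))
      fun x => mul_le_mul_of_nonneg_right (hwle m x) (hg0 x)
  refine ⟨fun m => 2 ^ (6 * n) * ∑' x, |w m x| * g x, ?_, ?_⟩
  · -- the defect majorant tends to zero: dominated convergence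
    have hpt : ∀ x, Tendsto (fun m => |w m x| * g x) atTop (𝓝 0) := by
      intro x
      have h1 : Tendsto (fun m => tm m x) atTop (𝓝 (W x)) := tendsto_torusMomentStr_infVolWeight r hlim q x
      have h2 : Tendsto (fun m => (if x ∈ Fintype.piFinset (fun _ : Fin n => box 4 (S m)) then tm m x else 0))
          atTop (𝓝 (W x)) := by
        refine h1.congr' ?_
        filter_upwards [eventually_mem_piFinset_box hS x] with m hm
        rw [if_pos hm]
      have h3 : Tendsto (fun m => w m x) atTop (𝓝 0) := by
        have := h2.sub_const (W x)
        rwa [sub_self] at this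
      have h4 := h3.abs.mul_const (g x)
      rwa [abs_zero, zero_mul] at h4
    have hbound : ∀ᶠ m in atTop, ∀ x, ‖|w m x| * g x‖ ≤ 2 * (Cp + Cp) ^ n * g x :=
      Eventually.of_forall fun m x => by
        rw [Real.norm_of_nonneg (mul_nonneg (abs_nonneg _) (hg0 x))]
        exact mul_le_mul_of_nonneg_right (hwle m x) (hg0 x)
    have key := tendsto_tsum_of_dominated_convergence (hgsum.mul_left (2 * (Cp + Cp) ^ n)) hpt hbound
    rw [tsum_zero] at key
    have := key.const_mul ((2 : ℝ) ^ (6 * n))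
    rwa [mul_zero] at this
  · -- the operator-norm bound
    intro m F
    set y : (Fin n → Site 4) → (Fin n → EuclideanSpace ℝ (Fin 4)) := fun x l => a • siteToE (x l) with hy
    have hyx : ∀ x l, ‖y x l - a • siteToE (x l)‖ ≤ 0 * a := fun x l => by simp [hy]
    -- the torus functional as a series of the cut-off weights
    have hcutW : ∀ x, |(if x ∈ Fintype.piFinset (fun _ : Fin n => box 4 (S m)) then tm m x else 0)| ≤
        (Cp + Cp) ^ n := hcut m
    have hsum1 : Summable fun x : Fin n → Site 4 =>
        (((if x ∈ Fintype.piFinset (fun _ : Fin n => box 4 (S m)) then tm m x else 0 : ℝ) : ℝ) : ℂ) * F (y x) :=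
      summable_mul_of_bounded ha ha1 hsa hB _ hcutW F y hyx
    have hsum2 : Summable fun x : Fin n → Site 4 => ((W x : ℝ) : ℂ) * F (y x) :=
      summable_mul_of_bounded ha ha1 hsa hB W hWle F y hyx
    have hT : latticeDistStr r.ρ β (S m) a (fun i U => plaquetteObs r.ρ 0 (q i).1 (q i).2 U)
        (fun i => wilsonTorusMean r.ρ β (S m) (fun U => plaquetteObs r.ρ 0 (q i).1 (q i).2 U)) F =
        ∑' x : Fin n → Site 4,
          (((if x ∈ Fintype.piFinset (fun _ : Fin n => box 4 (S m)) then tm m x else 0 : ℝ) : ℝ) : ℂ) *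
            F (y x) := by
      rw [latticeDistStr_apply, tsum_eq_sum (s := Fintype.piFinset (fun _ : Fin n => box 4 (S m)))
        (fun x hx => by simp only [if_neg hx, Complex.ofReal_zero, zero_mul])]
      exact Finset.sum_congr rfl fun x hx => by simp only [if_pos hx, htm, hy]
    have hdiff : latticeDistStr r.ρ β (S m) a (fun i U => plaquetteObs r.ρ 0 (q i).1 (q i).2 U)
        (fun i => wilsonTorusMean r.ρ β (S m) (fun U => plaquetteObs r.ρ 0 (q i).1 (q i).2 U)) F -
        ∑' x : Fin n → Site 4, ((W x : ℝ) : ℂ) * F (y x) =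
        ∑' x : Fin n → Site 4, ((w m x : ℝ) : ℂ) * F (y x) := by
      rw [hT, ← Summable.tsum_sub hsum1 hsum2]
      refine tsum_congr fun x => ?_
      simp only [hw, Complex.ofReal_sub, sub_mul]
    -- termwise bound by the majorant
    have hterm : ∀ x, ‖((w m x : ℝ) : ℂ) * F (y x)‖ ≤ (2 ^ (6 * n) * schwartzNorm (6 * n) F) * (|w m x| * g x) :=
      fun x => by
      rw [norm_mul, Complex.norm_real, Real.norm_eq_abs]
      have hF := norm_apply_le_schwartzNorm_mul_prod ha.le hsa F x (y x) (hyx x)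
      calc |w m x| * ‖F (y x)‖ ≤ |w m x| * (2 ^ (6 * n) * schwartzNorm (6 * n) F * g x) :=
            mul_le_mul_of_nonneg_left hF (abs_nonneg _)
        _ = _ := by ring
    have hsumM : Summable fun x => (2 ^ (6 * n) * schwartzNorm (6 * n) F) * (|w m x| * g x) := (hwg m).mul_left _
    rw [hdiff]
    calc ‖∑' x : Fin n → Site 4, ((w m x : ℝ) : ℂ) * F (y x)‖
        ≤ ∑' x : Fin n → Site 4, ‖((w m x : ℝ) : ℂ) * F (y x)‖ :=
          norm_tsum_le_tsum_norm (hsumM.of_nonneg_of_le (fun x => norm_nonneg _) hterm)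
      _ ≤ ∑' x : Fin n → Site 4, (2 ^ (6 * n) * schwartzNorm (6 * n) F) * (|w m x| * g x) :=
          Summable.tsum_le_tsum hterm (hsumM.of_nonneg_of_le (fun x => norm_nonneg _) hterm) hsumM
      _ = (2 ^ (6 * n) * schwartzNorm (6 * n) F) * ∑' x : Fin n → Site 4, |w m x| * g x := tsum_mul_left
      _ = (2 ^ (6 * n) * ∑' x, |w m x| * g x) * schwartzNorm (6 * n) F := by ring

/-- **THE CEILING-FREE (A)↔(B) JUNCTION FOR GIVEN STATES.**  For couplings `β_k` with `0 < a(β_k) ≤ 1`, GIVEN odd-torus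
limit states `μ_k ∈ oddTorusLimitPoints r β_k` and any growth demand `g`, there are torus sides `L_k ≥ g_k`, each a member
of `μ_k`'s defining odd-torus sequence, along which the spine's torus plane-string distributions are asymptotic to the
infinite-volume series of `μ_k`, for EVERY Schwartz test function (operator-norm defects `≤ ‖F‖/(k+1)` by
`exists_defect_tendsto_zero` and the diagonal selection `exists_growth_diagonal`).  No moment bound is used. [folklore] -/
theorem exists_torusSides_approximating (r : LatticeRep G) {a : ℝ → ℝ} (β : ℕ → ℝ)
    (ha : ∀ k, 0 < a (β k)) (ha1 : ∀ k, a (β k) ≤ 1)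
    (μ : ℕ → Measure (LGConfig 4 G)) (hμ : ∀ k, μ k ∈ oddTorusLimitPoints r (β k)) (g : ℕ → ℕ) :
    ∃ L : ℕ → ℕ, (∀ k, g k ≤ L k) ∧
      (∀ k, ∃ S : ℕ → ℕ, StrictMono S ∧ IsInfiniteVolumeLimitAlong (d := 4) r.ρ (β k) (fun j => 2 * S j) (μ k) ∧
        L k ∈ Set.range S) ∧
      ∀ (n : ℕ) (q : Fin n → Fin 4 × Fin 4) (F : 𝓢((Fin n → (EuclideanSpace ℝ (Fin 4))), ℂ)),
        Tendsto (fun k => latticeDistStr r.ρ (β k) (L k) (a (β k)) (fun i U => plaquetteObs r.ρ 0 (q i).1 (q i).2 U)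
            (fun i => wilsonTorusMean r.ρ (β k) (L k) (fun U => plaquetteObs r.ρ 0 (q i).1 (q i).2 U)) F -
          ∑' x : Fin n → Site 4,
            (((∫ U, ∏ i, (plane G r (q i) (x i) U - ∫ V, plane G r (q i) (x i) V ∂(μ k)) ∂(μ k) : ℝ) : ℂ)) *
              F (fun l => a (β k) • siteToE (x l))) atTop (𝓝 0) := by
  classical
  choose S hS hlim using hμ
  -- defect majorants for every level and every (arity, string)
  have hδ := fun (k : ℕ) (i : Σ n : ℕ, (Fin n → Fin 4 × Fin 4)) =>
    exists_defect_tendsto_zero r (hS k) (hlim k) (ha k) (ha1 k) i.2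
  choose δ hδ0 hδb using hδ
  obtain ⟨Ld, hLdg, hLd⟩ := exists_growth_diagonal (ι := Σ n : ℕ, (Fin n → Fin 4 × Fin 4)) (E := ℝ)
    (fun k i m => δ k i m) (fun _ _ => 0) (fun k i => hδ0 k i) g
  refine ⟨fun k => S k (Ld k), fun k => (hLdg k).trans ((hS k).id_le _), fun k => ⟨S k, hS k, hlim k, Ld k, rfl⟩,
    fun n q F => ?_⟩
  have hev := hLd ⟨n, q⟩
  have hlim0 : Tendsto (fun k : ℕ => 1 / ((k : ℝ) + 1) * schwartzNorm (6 * n) F) atTop (𝓝 0) := by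
    have := tendsto_one_div_add_atTop_nhds_zero_nat.mul_const (schwartzNorm (6 * n) F)
    rwa [zero_mul] at this
  refine squeeze_zero_norm' ?_ hlim0
  filter_upwards [hev] with k hk
  have hk' : δ k ⟨n, q⟩ (Ld k) ≤ 1 / ((k : ℝ) + 1) := by
    rw [sub_zero, Real.norm_eq_abs] at hk
    exact (le_abs_self _).trans hk
  exact (hδb k ⟨n, q⟩ (Ld k) F).trans (mul_le_mul_of_nonneg_right hk' (schwartzNorm_nonneg _ _))

end Junction

end Summit.QuantumFields.YangMills.Theorems.InfiniteVolume.PerOrderState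

end
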